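/-
Origin: expansion seat `planner-pub-hodgecm-pv09-0`, handover 2026-08-18T03:35:39Z (`HOME/pub-hodgecm-pv09/lean/Pv09/DoublingOrbit.lean`, md5 c7e3383f, 283 lines);
landed by the gen-5 packager in gate run 19 as `HodgeCM/PerL34/DoublingOrbit.lean` (verbatim).
-/
/-
pub-hodgecm speedrun cell, prover pv09 — WIP module `Pv09.DoublingOrbit` (landing target
`HodgeCM/PerL34/DoublingOrbit.lean`).  Imports Mathlib only.  Nothing is posited: every statement is proved.

# N31e (PerL v5, proof of Lemma 4.2(b)), the ORBIT LEMMA, tex ll. 588–590 (verbatim):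

  "The isotropic lines of $W^\square$ over $L_0$ are the lines $\iota(1,\delta')W^\Delta=\{(x,\delta'x)\}$,
  $\delta'\in\U(W_i)(L_0)$: one orbit under $\iota(\U(W_i)(L_0)\times\U(W_i)(L_0))$ with stabiliser the
  diagonal, so $P(L_0)\backslash H(L_0)=\{P\,\iota(1,\delta')^{-1}\}_{\delta'\in\U(W_i)(L_0)}$ and
  $E(\iota(u,u'),s_0;f_\Phi)=\sum_{\delta'\in\U(W_i)(L_0)}f_\Phi(\iota(u,\delta'^{-1}u'),s_0)$."

SETTING.  `L` = the CM field with `star` = complex conjugation (fixed field `L₀`); `W` = the hermitian LINE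
`W_i` (`IsLine L W`); `h : W →ₗ⋆[L] W →ₗ[L] L` its (anisotropic) hermitian form in Mathlib's sesquilinear
convention — the same type as `HodgeCM.PerL34.Doubling.Sesq L W` of node N31b (pv05), and
`boxForm h x y = h x.1 y.1 - h x.2 y.2` is DEFINITIONALLY pv05's `hbox h x y` (the form of `W^□ = W ⊕ (−W)`).
`U(W_i)(L₀)` = `unitary L` (norm-one elements, acting on the line by scalars); `H(L₀)` = `isomBox h` (all
`L`-linear isometries of `W^□`); `P(L₀)` = `stabDelta h` (stabiliser of the line `W^Δ = {(w,w)}`);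
`ι(1,δ')` = `iotaSnd h δ'` (`(w₁,w₂) ↦ (w₁, δ'w₂)`).

CONTENT (all kernel-proved):
* `isotropic_vector`   — l. 588: a non-zero isotropic vector of `W^□` is `(x, δ'x)` with `x ≠ 0`, `N(δ') = 1`;
* `orbit_existsUnique` — l. 589: for every `γ ∈ H(L₀)` there is a UNIQUE `δ' ∈ U(W_i)(L₀)` with
                          `γ·ι(1,δ') ∈ P(L₀)`, i.e. `P(L₀)\H(L₀) = {P ι(1,δ')⁻¹}` bijectively
                          (one orbit; uniqueness = "stabiliser the diagonal");
* `rightCosetEquiv`, `hasSum_rightCosets_iff` — abstract re-indexing of a sum over `P\H` by such a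
                          parametrisation (pure group theory);
* `eisenstein_reindex` — l. 590: `Σ_{P(L₀)\H(L₀)} F = Σ_{δ'∈U(W_i)(L₀)} F(ι(1,δ')⁻¹)` for left-`P(L₀)`-invariant
                          `F` (apply to `F(γ) = f_Φ(γ·ι(u,u'),s₀)`; then `ι(1,δ')⁻¹ι(u,u') = ι(u,δ'⁻¹u')` because
                          `ι` is a homomorphism — `iotaSnd_inv_mul`).
-/
import Mathlib

set_option autoImplicit false

namespace HodgeCM.PerL34.RallisIP

/-! ## 1. Abstract re-indexing of a sum over right cosets `P\𝓗` (pure group theory) -/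

section reindex

variable {𝓗 : Type*} [Group 𝓗] (P : Subgroup 𝓗) {Γ' : Type*} (e : Γ' → 𝓗)

/-- A left-`P`-invariant function on `𝓗` descends to the right-coset space `P\𝓗`
(Mathlib: `Quotient (QuotientGroup.rightRel P)`, classes `P·γ`). -/
def cosetLift {M : Type*} (F : 𝓗 → M) (hF : ∀ p ∈ P, ∀ γ : 𝓗, F (p * γ) = F γ) :
    Quotient (QuotientGroup.rightRel P) → M :=
  Quotient.lift F (by
    intro a b hab
    have hab' : b * a⁻¹ ∈ P := QuotientGroup.rightRel_apply.mp hab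
    have := hF (b * a⁻¹) hab' a
    rw [inv_mul_cancel_right] at this
    exact this.symm)

/-- (Ported verbatim from the HodgeCMPerL package; no docstring in the source.) -/
@[simp] theorem cosetLift_mk {M : Type*} (F : 𝓗 → M) (hF : ∀ p ∈ P, ∀ γ : 𝓗, F (p * γ) = F γ) (γ : 𝓗) :
    cosetLift P F hF (Quotient.mk (QuotientGroup.rightRel P) γ) = F γ := rfl

/-- If every `γ ∈ 𝓗` lies in `P·(e d)⁻¹` for a UNIQUE `d`, then `d ↦ P·(e d)⁻¹` is a bijection `Γ' ≃ P\𝓗`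
(this is "`P(L₀)\H(L₀) = {P ι(1,δ')⁻¹}_{δ'}`", tex l. 589–590). -/
noncomputable def rightCosetEquiv (horbit : ∀ γ : 𝓗, ∃! d : Γ', γ * e d ∈ P) :
    Γ' ≃ Quotient (QuotientGroup.rightRel P) :=
  Equiv.ofBijective (fun d => Quotient.mk (QuotientGroup.rightRel P) (e d)⁻¹) (by
    constructor
    · intro d d' hdd'
      have hmem : (e d')⁻¹ * ((e d)⁻¹)⁻¹ ∈ P := QuotientGroup.rightRel_apply.mp (Quotient.exact hdd')
      rw [inv_inv] at hmem
      obtain ⟨d₀, -, huniq⟩ := horbit (e d')⁻¹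
      rw [huniq d hmem, huniq d' (show (e d')⁻¹ * e d' ∈ P by rw [inv_mul_cancel]; exact P.one_mem)]
    · intro q
      induction q using Quotient.inductionOn with
      | h γ =>
        obtain ⟨d, hd, -⟩ := horbit γ
        refine ⟨d, Quotient.sound ?_⟩
        exact QuotientGroup.rightRel_apply.mpr (by rw [inv_inv]; exact hd))

/-- Re-indexing: `Σ_{P\𝓗} F = Σ_{d ∈ Γ'} F((e d)⁻¹)` (as an equivalence of `HasSum` statements, so it carries
absolute/unconditional convergence either way). -/
theorem hasSum_rightCosets_iff (horbit : ∀ γ : 𝓗, ∃! d : Γ', γ * e d ∈ P)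
    {M : Type*} [AddCommMonoid M] [TopologicalSpace M]
    (F : 𝓗 → M) (hF : ∀ p ∈ P, ∀ γ : 𝓗, F (p * γ) = F γ) (s : M) :
    HasSum (cosetLift P F hF) s ↔ HasSum (fun d => F (e d)⁻¹) s := by
  rw [← (rightCosetEquiv P e horbit).hasSum_iff]
  rfl

end reindex

/-! ## 2. The hermitian line, `W^□ = W ⊕ (−W)`, its isotropic vectors and the orbit lemma -/

section line

variable {L : Type*} [Field L] [StarRing L] {W : Type*} [AddCommGroup W] [Module L W]

/-- `W` is a LINE over `L`: some non-zero vector of which every vector is a multiple (tex l. 230: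
`U(W_i) = U(1)`, `dim_L W_i = 1`). -/
def IsLine (L : Type*) (W : Type*) [Field L] [AddCommGroup W] [Module L W] : Prop :=
  ∃ w₀ : W, w₀ ≠ 0 ∧ ∀ w : W, ∃ c : L, w = c • w₀

/-- the hermitian form of `W^□ = W ⊕ (−W)` (tex l. 549), written out; definitionally pv05's `hbox h x y`. -/
def boxForm (h : W →ₗ⋆[L] W →ₗ[L] L) (x y : W × W) : L := h x.1 y.1 - h x.2 y.2

/-- `h` is anisotropic (for a hermitian line over a CM field: `h(cw₀,cw₀) = N_{L/L₀}(c)·h(w₀,w₀) ≠ 0`). -/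
def Anisotropic (h : W →ₗ⋆[L] W →ₗ[L] L) : Prop := ∀ w : W, h w w = 0 → w = 0

omit [StarRing L] in
/-- (Ported verbatim from the HodgeCMPerL package; no docstring in the source.) -/
theorem IsLine.exists_smul_eq (hW : IsLine L W) {x : W} (hx : x ≠ 0) (w : W) : ∃ c : L, w = c • x := by
  obtain ⟨w₀, _, hgen⟩ := hW
  obtain ⟨a, rfl⟩ := hgen x
  obtain ⟨c, rfl⟩ := hgen w
  have ha : a ≠ 0 := by rintro rfl; exact hx (zero_smul L w₀)
  exact ⟨c * a⁻¹, by rw [smul_smul, mul_assoc, inv_mul_cancel₀ ha, mul_one]⟩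

/-- (Ported verbatim from the HodgeCMPerL package; no docstring in the source.) -/
theorem sesq_smul_smul (h : W →ₗ⋆[L] W →ₗ[L] L) (c : L) (x y : W) :
    h (c • x) (c • y) = star c * c * h x y := by
  simp only [LinearMap.map_smulₛₗ, LinearMap.smul_apply, map_smul, smul_eq_mul, starRingEnd_apply]
  ring

/-- (Ported verbatim from the HodgeCMPerL package; no docstring in the source.) -/
@[simp] theorem boxForm_diag (h : W →ₗ⋆[L] W →ₗ[L] L) (v w : W) : boxForm h (v, v) (w, w) = 0 := by
  simp [boxForm]

/-- **tex l. 588** — the isotropic vectors of `W^□`: a non-zero isotropic `x = (x₁,x₂)` has `x₁ ≠ 0` and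
`x₂ = δ'x₁` with `N(δ') = star δ' * δ' = 1`, i.e. it spans the line `ι(1,δ')W^Δ = {(w, δ'w)}`. -/
theorem isotropic_vector {h : W →ₗ⋆[L] W →ₗ[L] L} (hW : IsLine L W) (hh : Anisotropic h)
    {x : W × W} (hx : x ≠ 0) (hiso : boxForm h x x = 0) :
    x.1 ≠ 0 ∧ ∃ u : L, star u * u = 1 ∧ x.2 = u • x.1 := by
  have heq : h x.1 x.1 = h x.2 x.2 := sub_eq_zero.mp hiso
  have hx1 : x.1 ≠ 0 := by
    intro h1
    have h2 : x.2 = 0 := hh x.2 (by rw [← heq, h1]; simp)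
    exact hx (Prod.ext h1 h2)
  refine ⟨hx1, ?_⟩
  obtain ⟨u, hu⟩ := hW.exists_smul_eq hx1 x.2
  refine ⟨u, ?_, hu⟩
  have hne : h x.1 x.1 ≠ 0 := fun h0 => hx1 (hh x.1 h0)
  rw [hu, sesq_smul_smul] at heq
  exact (mul_eq_right₀ hne).mp heq.symm

/-- `H(L₀)`: the `L`-linear isometries of `(W^□, h ⊕ (−h))` (tex l. 552; = pv05's `isom (hbox h)`). -/
def isomBox (h : W →ₗ⋆[L] W →ₗ[L] L) : Subgroup ((W × W) ≃ₗ[L] (W × W)) where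
  carrier := {γ | ∀ x y : W × W, boxForm h (γ x) (γ y) = boxForm h x y}
  mul_mem' := by
    intro a b ha hb x y
    simp only [Set.mem_setOf_eq, LinearEquiv.mul_apply] at *
    rw [ha, hb]
  one_mem' := by intro x y; rfl
  inv_mem' := by
    intro g hg x y
    simp only [Set.mem_setOf_eq, LinearEquiv.coe_inv] at *
    have := hg (g.symm x) (g.symm y)
    simpa using this.symm

/-- (Ported verbatim from the HodgeCMPerL package; no docstring in the source.) -/
theorem mem_isomBox_iff (h : W →ₗ⋆[L] W →ₗ[L] L) (γ : (W × W) ≃ₗ[L] (W × W)) :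
    γ ∈ isomBox h ↔ ∀ x y : W × W, boxForm h (γ x) (γ y) = boxForm h x y := Iff.rfl

variable (L W) in
/-- `P(L₀)` (inside `GL(W^□)`): the transformations under which the isotropic line `W^Δ = {(w,w)}` is stable
(`x ∈ W^Δ ↔ p x ∈ W^Δ`; tex l. 550, 589). -/
def stabDelta : Subgroup ((W × W) ≃ₗ[L] (W × W)) where
  carrier := {p | ∀ x : W × W, x.1 = x.2 ↔ (p x).1 = (p x).2}
  mul_mem' := by
    intro a b ha hb x
    rw [Set.mem_setOf_eq] at *
    rw [LinearEquiv.mul_apply]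
    exact (hb x).trans (ha (b x))
  one_mem' := by intro x; exact Iff.rfl
  inv_mem' := by
    intro g hg x
    rw [Set.mem_setOf_eq] at *
    have := hg (g⁻¹ x)
    rw [show g (g⁻¹ x) = x from by rw [LinearEquiv.coe_inv]; exact g.apply_symm_apply x] at this
    exact this.symm

omit [StarRing L] in
/-- (Ported verbatim from the HodgeCMPerL package; no docstring in the source.) -/
theorem mem_stabDelta_iff (p : (W × W) ≃ₗ[L] (W × W)) :
    p ∈ stabDelta L W ↔ ∀ x : W × W, x.1 = x.2 ↔ (p x).1 = (p x).2 := Iff.rfl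

/-- (Ported verbatim from the HodgeCMPerL package; no docstring in the source.) -/
theorem unitary_coe_ne_zero (u : unitary L) : (u : L) ≠ 0 := by
  intro h0
  have := Unitary.coe_star_mul_self u
  rw [h0, mul_zero] at this
  exact zero_ne_one this

/-- `ι(1,δ')` for `δ' ∈ U(W_i)(L₀) = unitary L`: `(w₁,w₂) ↦ (w₁, δ'w₂)` (tex l. 552, 588). -/
def iotaSnd (u : unitary L) : (W × W) ≃ₗ[L] (W × W) :=
  (LinearEquiv.refl L W).prodCongr (LinearEquiv.smulOfUnit (Units.mk0 (u : L) (unitary_coe_ne_zero u)))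

/-- (Ported verbatim from the HodgeCMPerL package; no docstring in the source.) -/
@[simp] theorem iotaSnd_apply (u : unitary L) (x : W × W) :
    iotaSnd (W := W) u x = (x.1, (u : L) • x.2) := rfl

/-- `ι(1,δ') ∈ H(L₀)`: it is an isometry of `W^□` because `N(δ') = 1`. -/
theorem iotaSnd_mem (h : W →ₗ⋆[L] W →ₗ[L] L) (u : unitary L) : iotaSnd (W := W) u ∈ isomBox h := by
  intro x y
  simp only [iotaSnd_apply, boxForm]
  rw [sesq_smul_smul, Unitary.coe_star_mul_self, one_mul]

/-- **tex l. 589–590 — ONE ORBIT, STABILISER THE DIAGONAL.**  For every `γ ∈ H(L₀)` there is a UNIQUE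
`δ' ∈ U(W_i)(L₀)` with `γ·ι(1,δ') ∈ P(L₀)`, i.e. `γ ∈ P(L₀)·ι(1,δ')⁻¹`; equivalently `γ⁻¹W^Δ = ι(1,δ')W^Δ`
(every isotropic line is some `ι(1,δ')W^Δ`, and distinct `δ'` give distinct lines). -/
theorem orbit_existsUnique {h : W →ₗ⋆[L] W →ₗ[L] L} (hW : IsLine L W) (hh : Anisotropic h)
    {γ : (W × W) ≃ₗ[L] (W × W)} (hγ : γ ∈ isomBox h) :
    ∃! u : unitary L, γ * iotaSnd u ∈ stabDelta L W := by
  obtain ⟨w₀, hw₀, hgen⟩ := id hW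
  set y : W × W := γ.symm (w₀, w₀) with hy
  have hγy : γ y = (w₀, w₀) := by simp [hy]
  have hy0 : y ≠ 0 := by
    intro h0
    have : (w₀, w₀) = (0 : W × W) := by rw [← hγy, h0, map_zero]
    exact hw₀ (Prod.mk.inj this).1
  have hyiso : boxForm h y y = 0 := by rw [← hγ y y, hγy, boxForm_diag]
  obtain ⟨hy1, u, hu1, hy2⟩ := isotropic_vector hW hh hy0 hyiso
  have hu0 : u ≠ 0 := by rintro rfl; rw [mul_zero] at hu1; exact zero_ne_one hu1
  let U : unitary L := ⟨u, Unitary.mem_iff_star_mul_self.mpr hu1⟩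
  -- (K): a vector is sent into W^Δ by γ iff it is a multiple of y
  have K : ∀ v : W × W, (γ v).1 = (γ v).2 → ∃ c : L, v = c • y := by
    intro v hv
    obtain ⟨c, hc⟩ := hW.exists_smul_eq hw₀ (γ v).1
    refine ⟨c, γ.injective ?_⟩
    rw [map_smul, hγy, Prod.smul_mk, ← hc]
    exact Prod.ext rfl hv.symm
  have K' : ∀ c : L, (γ (c • y)).1 = (γ (c • y)).2 := by
    intro c; rw [map_smul, hγy]; rfl
  -- membership criterion for γ * ι(1,u')
  have crit : ∀ u' : unitary L, (γ * iotaSnd u' ∈ stabDelta L W ↔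
      ∀ x : W × W, x.1 = x.2 ↔ (γ (x.1, (u' : L) • x.2)).1 = (γ (x.1, (u' : L) • x.2)).2) := by
    intro u'; rw [mem_stabDelta_iff]; simp only [LinearEquiv.mul_apply, iotaSnd_apply]
  refine ⟨U, ?_, ?_⟩
  · -- existence: γ ι(1,u) stabilises W^Δ
    show γ * iotaSnd U ∈ stabDelta L W
    rw [crit]
    intro x
    constructor
    · intro hx
      obtain ⟨c, hc⟩ := hW.exists_smul_eq hy1 x.1
      have e : (x.1, (U : L) • x.2) = c • y := by
        rw [← hx, hc]
        change (c • y.1, u • c • y.1) = c • y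
        rw [smul_smul, mul_comm, ← smul_smul, ← hy2]
        rfl
      rw [e]; exact K' c
    · intro hx
      obtain ⟨c, hc⟩ := K _ hx
      rw [Prod.ext_iff] at hc
      obtain ⟨hc1, hc2⟩ := hc
      simp only [Prod.smul_fst, Prod.smul_snd] at hc1 hc2
      rw [hy2, smul_smul, mul_comm, ← smul_smul] at hc2
      rw [hc1]
      exact (smul_right_injective W hu0 hc2).symm
  · -- uniqueness: "stabiliser the diagonal"
    intro U' hU'
    rw [crit] at hU'
    obtain ⟨c, hc⟩ := K _ ((hU' (y.1, y.1)).mp rfl)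
    rw [Prod.ext_iff] at hc
    obtain ⟨hc1, hc2⟩ := hc
    simp only [Prod.smul_fst, Prod.smul_snd] at hc1 hc2
    have hc1' : c = 1 := by
      have : c • y.1 = (1 : L) • y.1 := by rw [one_smul]; exact hc1.symm
      exact smul_left_injective L hy1 this
    rw [hc1', one_smul, hy2] at hc2
    apply Subtype.ext
    exact smul_left_injective L hy1 hc2

/-- **tex l. 590 — the Eisenstein sum re-indexed**: for any left-`P(L₀)`-invariant `F` on `H(L₀)` (e.g.
`F(γ) = f_Φ(γ·ι(u,u'), s₀)`, `f_Φ(·,s₀)` being left `P(L₀)`-invariant, tex l. 572),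
`Σ_{P(L₀)\H(L₀)} F = Σ_{δ' ∈ U(W_i)(L₀)} F(ι(1,δ')⁻¹)`, as an equivalence of `HasSum` statements. -/
theorem eisenstein_reindex {h : W →ₗ⋆[L] W →ₗ[L] L} (hW : IsLine L W) (hh : Anisotropic h)
    {M : Type*} [AddCommMonoid M] [TopologicalSpace M]
    (F : isomBox h → M)
    (hF : ∀ p ∈ (stabDelta L W).subgroupOf (isomBox h), ∀ γ : isomBox h, F (p * γ) = F γ) (s : M) :
    HasSum (cosetLift ((stabDelta L W).subgroupOf (isomBox h)) F hF) s ↔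
      HasSum (fun d : unitary L => F (⟨iotaSnd d, iotaSnd_mem h d⟩ : isomBox h)⁻¹) s :=
  hasSum_rightCosets_iff ((stabDelta L W).subgroupOf (isomBox h))
    (fun d : unitary L => (⟨iotaSnd d, iotaSnd_mem h d⟩ : isomBox h))
    (fun γ => by
      simp only [Subgroup.mem_subgroupOf, Subgroup.coe_mul]
      exact orbit_existsUnique hW hh γ.2)
    F hF s

/-- `ι(1,δ')⁻¹ = ι(1,δ'⁻¹)`, so that `ι(1,δ')⁻¹·ι(u,u') = ι(u, δ'⁻¹u')` (tex l. 590). -/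
theorem iotaSnd_inv (u : unitary L) : (iotaSnd (W := W) u)⁻¹ = iotaSnd u⁻¹ := by
  rw [inv_eq_iff_mul_eq_one]
  ext x <;> simp [LinearEquiv.mul_apply, smul_smul, Unitary.coe_inv, unitary_coe_ne_zero]

end line

end HodgeCM.PerL34.RallisIP
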